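import Summits.NavierStokesRegularity.FluidComputer.PalasekTowerHostLateFade
import Summits.NavierStokesRegularity.FluidComputer.PalasekTowerHostLateFadeEngineBound
import Summits.NavierStokesRegularity.FluidComputer.PalasekTowerHostLateFadeEngineOseen
import Summits.NavierStokesRegularity.FluidComputer.PalasekTowerHeredityWitnessUnconditionalRungs
import Summits.NavierStokesRegularity.FluidComputer.PalasekTowerHeredityWitnessCalibration
import Summits.NavierStokesRegularity.NavierStokesRegularity.Theses.PalasekTowerBreakdown

/-!
# Negative lane of crux `EpisodeBase` (stmt-NavierStokesRegularity-19179): the ∀-over-hosts trap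
# `FirstEpisode = HeredityAt 0` is FALSE modulo ONE engine lemma — hold-and-release

Cell `ns-blowup`, seat `ns-blowup-ecbridge-1` (g6). LABEL: E–C typing, NEGATIVE lane (kernel). WHAT THIS
IS NOT: not Navier–Stokes evidence and NOT a refutation of any ITEM — `EpisodeBase` (`EpisodeBaseG`) is
∃-form and untouched; `FirstEpisode` (`= HeredityAt 0 = HeredityWitness 0 ↔ …`, the planner's BC3 stub
`first_episode` of the ORIGINAL 19179 skeleton, WITHDRAWN as a filing shape by RULING STATUS l.1890 and
kept as a NAMED TRAP in `FluidComputer/PalasekTowerRegisterGlobalBase.lean`) is shown false GIVEN the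
engine hypothesis `Host.ForcedLerayShortTimeBound` (`FluidComputer/PalasekTowerHostLateFade.lean` §4:
Leray's short-time sup bound for finite-energy classical solutions WITH a Clay force — the forced twin of
the tree's PROVED `exists_norm_le_two_mul_of_finiteEnergy_from`; open in the tree). refuter4 K53 had this
trap as «misstated-by-design, not desk-refutable»; this file locates EXACTLY what a desk refutation costs.

THE HOLD-AND-RELEASE LEVER. ecbridge-3's registered level-`0` host (`PalasekTowerHost*`, p428335) is a
PRESCRIBED flow `vel` whose force is its own NS-residual; its schedule fades the force out across the
whole first window. Re-force it by `forceL = fade_{τ₁, ε} • resid` (`PalasekTowerHostLateFade`): the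
residual is HELD until `τ₁ − ε` and released on `[τ₁ − ε, τ₁]` (admissible: `≤ Y₀/200` on the window,
quiet from `τ₁`, Clay, confined; pins/rigidity unchanged; the level-`0` stage transports because both
forces are the residual on `[0, 1]`). Suppose a level-`1` stage `s₁` of this schedule existed. On
`[0, τ₁ − ε]` both `s₁.u` and `vel` are finite-energy classical solutions with the same Clay force and
datum, `vel` bounded (`≤ Y₀`): the tree's W14-free uniqueness `velocity_eq_of_bounded_classical`
(forced Serrin–Masuda) gives `s₁.u = vel` there, so `|s₁.u(τ₁ − ε, ·)| ≤ Y₀`. On `[τ₁ − ε, τ₁]` the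
engine hypothesis (with `A = Y₀`, a-priori bound `M = (5/3)Y₁` = the stage's own level-`1` ceiling,
`η = (Y₁ − 2Y₀)/2 > 0` — certified `Y₀ < 1352`, `2778 < Y₁`) bounds
`|s₁.u(τ₁, ·)| ≤ 2Y₀ + η < Y₁`, contradicting the level-`1` speed floor `Y₁ ≤ |s₁.u(τ₁, x₁)|`
(`c₁ = 1`). Hence NO level-`1` stage exists for the late-fade schedule (`isEmpty_stage_one_lateFade`),
while its level-`0` stage does: `FirstEpisode` (∀ hosts ⇒ a level-`1` extension) fails.

* `isEmpty_stage_one_lateFade` — the schedule-level statement (for `ε ≤ δ₀(H)`);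
* `firstEpisode_false_of_forcedLerayShortTimeBound : Host.ForcedLerayShortTimeBound → ¬ FirstEpisode`;
* corollaries `heredityAt_zero_false_of_…`, `heredityFrom_zero_false_of_…`, `heredityWitness_zero_false_of_…`.
NOT reached by this lever (the push is re-chosen by an ∃): `FirstEpisodeR`, `FirstEpisodeAll`
(refuter4's killplan `firstEpisodeR_false_of_Hmin`, evidence #17 on 19179, needs a tiny-blob host, which
dies on `AnchorGlobal` — STATUS l.3247 / ecbridge-1 g6 memo EC-BRIDGE-v5 §4).

References: S. Palasek, arXiv:2605.13827 §3.3–§4 [cite: Palasek2026ElementaryModel, §3.3];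
J. Leray, Acta Math. 63 (1934) §21 (3.15) [cite: Leray1934, §21 (3.15)]; H. Sohr, *The Navier–Stokes
Equations* (2001), Thm. V.1.5.1 [cite: Sohr2001, Ch. V Thm. 1.5.1]; C. L. Fefferman, Clay problem
description, (5)–(7) [cite: FeffermanClay2006, (5) (6)].
-/

noncomputable section

open Set MeasureTheory Metric
open scoped ENNReal

namespace Summit.NavierStokesRegularity.FirstEpisodeHoldRelease

open Literature.Analysis.FluidPDE
open Summit.NavierStokesRegularity.FluidComputer.PalasekTowerClayBridge
open Summit.NavierStokesRegularity.FluidComputer.PalasekTowerClayBridge.Host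

/-- Certified: `2·Y₀ < Y₁` strictly on the wide base (`Y₀ < 1352`, `2778 < Y₁`). [folklore] -/
theorem two_mul_wide_Y_zero_lt_Y_one : 2 * TowerRates.wide.Y 0 < TowerRates.wide.Y 1 := by
  have h0 := TowerRates.wide_Y_zero_bounds.2
  have h1 := TowerRates.wide_Y_one_bounds.1
  linarith

/-- **THE HOLD-AND-RELEASE LEVER, any level** (engine bound as a hypothesis): let `S` be a wide
schedule and `(v, q)` a PRESCRIBED bounded finite-energy classical solution of the system forced by
`S.f` on `[0, τ_{k+1} − ε]` from `S`'s datum («the schedule HOLDS `v` until `ε` before the readout»),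
with `|v(τ_{k+1} − ε, ·)| ≤ A`; if the forced short-time bound with data `(A, M = c₂Y_{k+1}, F, η)` holds
on slabs of length `≤ δ₀`, `ε ≤ δ₀`, the force slices have `∫|S.f(t)|² ≤ F²` on `[0, τ_{k+1}]`, and
`2A + η < c₁ Y_{k+1}`, then `S` carries NO registered stage at level `k + 1` (any margin `m`): uniqueness
pins such a stage to `v` up to `τ_{k+1} − ε`, the bound keeps it below the level-`(k+1)` speed floor at
`τ_{k+1}`. For `k ≥ 1` the register forbids holding (push `≤ c₄Y_k` cannot carry the strain floor
`A_k`); at `k = 0` the force before `τ₀` is free and ecbridge-3's host is held — next theorem.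
[cite: Palasek2026ElementaryModel, §3.3] [cite: Sohr2001, Ch. V Thm. 1.5.1] -/
theorem isEmpty_stage_succ_of_held {S : Schedule TowerRates.wide} {m : Margins TowerRates.wide} {k : ℕ}
    {ε δ₀ A B F η : ℝ} {v : ℝ → EuclideanSpace ℝ (Fin 3) → EuclideanSpace ℝ (Fin 3)} {q : ℝ → EuclideanSpace ℝ (Fin 3) → ℝ}
    (hε : 0 < ε) (hεδ : ε ≤ δ₀) (hετ : ε < S.τ (k + 1))
    (hv : IsClassicalNSSolutionOn (Icc 0 (S.τ (k + 1) - ε)) 1 S.f v q)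
    (hv0 : v 0 = S.u₀)
    (hvE : ∃ C : ℝ≥0∞, C < ⊤ ∧ ∀ t ∈ Icc 0 (S.τ (k + 1) - ε), ∫⁻ x, ‖v t x‖ₑ ^ 2 ≤ C)
    (hvB : ∀ t ∈ Icc 0 (S.τ (k + 1) - ε), ∀ x, ‖v t x‖ ≤ B)
    (hvA : ∀ x, ‖v (S.τ (k + 1) - ε) x‖ ≤ A)
    (hF : ∀ t ∈ Icc (0 : ℝ) (S.τ (k + 1)), ∫⁻ x, ‖S.f t x‖ₑ ^ 2 ≤ ENNReal.ofReal (F ^ 2))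
    (hgap : 2 * A + η < S.c₁ * TowerRates.wide.Y (k + 1))
    (hδ₀ : ∀ ⦃t₀ T : ℝ⦄ ⦃f u : ℝ → EuclideanSpace ℝ (Fin 3) → EuclideanSpace ℝ (Fin 3)⦄ ⦃p : ℝ → EuclideanSpace ℝ (Fin 3) → ℝ⦄, 0 ≤ t₀ → t₀ < T → T - t₀ ≤ δ₀ →
      IsSmoothOnHalfSpace f → HasRapidSpaceTimeDecay f →
      (∀ t ∈ Icc t₀ T, ∫⁻ x, ‖f t x‖ₑ ^ 2 ≤ ENNReal.ofReal (F ^ 2)) →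
      IsClassicalNSSolutionOn (Icc t₀ T) 1 f u p →
      (∃ C : ℝ≥0∞, C < ⊤ ∧ ∀ t ∈ Icc t₀ T, ∫⁻ x, ‖u t x‖ₑ ^ 2 ≤ C) →
      (∀ t ∈ Icc t₀ T, ∀ x, ‖u t x‖ ≤ S.c₂ * TowerRates.wide.Y (k + 1)) →
      (∀ x, ‖u t₀ x‖ ≤ A) →
      ∀ t ∈ Icc t₀ T, ∀ x, ‖u t x‖ ≤ 2 * A + η) :
    IsEmpty (Stage 1 TowerRates.wide S m (k + 1)) := by
  refine ⟨fun s₁ => ?_⟩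
  set τ' : ℝ := S.τ (k + 1) with hτ'
  have hcl : IsClassicalNSSolutionOn (Icc 0 τ') 1 S.f s₁.u s₁.p := s₁.classical
  have hE : ∃ C : ℝ≥0∞, C < ⊤ ∧ ∀ t ∈ Icc 0 τ', ∫⁻ x, ‖s₁.u t x‖ₑ ^ 2 ≤ C := s₁.energy
  have h0 : s₁.u 0 = v 0 := by rw [s₁.initial, hv0]
  have hM : ∀ t ∈ Icc 0 τ', ∀ x, ‖s₁.u t x‖ ≤ S.c₂ * TowerRates.wide.Y (k + 1) :=
    s₁.ceiling (k + 1) le_rfl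
  obtain ⟨x₁, -, hfloor⟩ := s₁.floor (k + 1) le_rfl
  -- (1) HOLD: on `[0, τ' - ε]` the stage IS the prescribed flow (W14-free uniqueness)
  have hT0 : 0 < τ' - ε := by linarith
  have hsub : Icc 0 (τ' - ε) ⊆ Icc 0 τ' := fun t ht => ⟨ht.1, by linarith [ht.2]⟩
  have hcl' : IsClassicalNSSolutionOn (Icc 0 (τ' - ε)) 1 S.f s₁.u s₁.p :=
    hcl.mono hsub (uniqueDiffOn_Icc hT0)
  have heq : ∀ t ∈ Icc 0 (τ' - ε), s₁.u t = v t :=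
    velocity_eq_of_bounded_classical one_pos hT0 S.force_smooth S.force_decay hv hvE hvB hcl'
      (by obtain ⟨C, hC, hb⟩ := hE; exact ⟨C, hC, fun t ht => hb t (hsub ht)⟩) h0
  have hA : ∀ x, ‖s₁.u (τ' - ε) x‖ ≤ A := by
    intro x
    rw [heq (τ' - ε) ⟨hT0.le, le_rfl⟩]
    exact hvA x
  -- (2) RELEASE: the engine bound on `[τ' - ε, τ']`
  have hsub' : Icc (τ' - ε) τ' ⊆ Icc 0 τ' := fun t ht => ⟨by linarith [ht.1], ht.2⟩
  have hcl'' : IsClassicalNSSolutionOn (Icc (τ' - ε) τ') 1 S.f s₁.u s₁.p :=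
    hcl.mono hsub' (uniqueDiffOn_Icc (by linarith))
  have hbound := hδ₀ hT0.le (by linarith) (by linarith) S.force_smooth S.force_decay
    (fun t ht => hF t (hsub' ht)) hcl''
    (by obtain ⟨C, hC, hb⟩ := hE; exact ⟨C, hC, fun t ht => hb t (hsub' ht)⟩)
    (fun t ht x => hM t (hsub' ht) x) hA τ' ⟨by linarith, le_rfl⟩ x₁
  -- (3) the level-(k+1) floor is missed
  linarith

/-- **NO LEVEL-1 STAGE FOR THE LATE-FADE SCHEDULE** (given the engine bound, for `ε` below its
`δ₀`): the lever at `k = 0` with `v` = ecbridge-3's prescribed host (`≤ Y₀`, `norm_vel_le`), held by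
`forceL` until `τ₁ − ε`; `2Y₀ + (Y₁ − 2Y₀)/2 < Y₁` by the certified bounds.
[cite: Palasek2026ElementaryModel, §3.3] [cite: Sohr2001, Ch. V Thm. 1.5.1] -/
theorem isEmpty_stage_one_lateFade {L Lb ε δ₀ F : ℝ} (hL : 1 ≤ L) (hLb : 1 ≤ Lb) (hε : 0 < ε)
    (hεw : ε ≤ wfirst) (hεδ : ε ≤ δ₀)
    (hpush : ∀ t ∈ Icc (1 : ℝ) τfirst, ∀ x : EuclideanSpace ℝ (Fin 3), ‖resid L Lb t x‖ ≤ 1 / 200 * TowerRates.wide.Y 0)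
    (hslab : ∀ x : EuclideanSpace ℝ (Fin 3), ‖slab L x‖ ≤ 11 / 10 * freq)
    (hF : ∀ t ∈ Icc (0 : ℝ) τfirst, ∫⁻ x, ‖resid L Lb t x‖ₑ ^ 2 ≤ ENNReal.ofReal (F ^ 2))
    (hδ₀ : ∀ ⦃t₀ T : ℝ⦄ ⦃f u : ℝ → EuclideanSpace ℝ (Fin 3) → EuclideanSpace ℝ (Fin 3)⦄ ⦃p : ℝ → EuclideanSpace ℝ (Fin 3) → ℝ⦄, 0 ≤ t₀ → t₀ < T → T - t₀ ≤ δ₀ →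
      IsSmoothOnHalfSpace f → HasRapidSpaceTimeDecay f →
      (∀ t ∈ Icc t₀ T, ∫⁻ x, ‖f t x‖ₑ ^ 2 ≤ ENNReal.ofReal (F ^ 2)) →
      IsClassicalNSSolutionOn (Icc t₀ T) 1 f u p →
      (∃ C : ℝ≥0∞, C < ⊤ ∧ ∀ t ∈ Icc t₀ T, ∫⁻ x, ‖u t x‖ₑ ^ 2 ≤ C) →
      (∀ t ∈ Icc t₀ T, ∀ x, ‖u t x‖ ≤ 5 / 3 * TowerRates.wide.Y 1) →
      (∀ x, ‖u t₀ x‖ ≤ TowerRates.wide.Y 0) →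
      ∀ t ∈ Icc t₀ T, ∀ x, ‖u t x‖ ≤ 2 * TowerRates.wide.Y 0 +
        (TowerRates.wide.Y 1 - 2 * TowerRates.wide.Y 0) / 2) :
    IsEmpty (Stage 1 TowerRates.wide (hostScheduleL L Lb ε hL hLb hε hpush)
      (Margins.routeG TowerRates.wide) 1) := by
  have hL0 : 0 < L := by linarith
  have hLb0 : 0 < Lb := by linarith
  have hτ₁ : τfirst = 1 + wfirst := τfirst_eq
  have hsep := two_mul_wide_Y_zero_lt_Y_one
  have hτ1 : (hostScheduleL L Lb ε hL hLb hε hpush).τ (0 + 1) = τfirst := rfl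
  obtain ⟨Cv, hCv, hEv⟩ := energy_vel_all hL0 hLb0 hslab
  refine isEmpty_stage_succ_of_held (S := hostScheduleL L Lb ε hL hLb hε hpush) (k := 0) (δ₀ := δ₀)
    (F := F) (A := TowerRates.wide.Y 0) (B := TowerRates.wide.Y 0) (η := (TowerRates.wide.Y 1 -
      2 * TowerRates.wide.Y 0) / 2) (v := vel L Lb) (q := pres L) hε hεδ ?_ ?_ ?_ ?_ ?_ ?_ ?_ ?_ ?_
  · rw [hτ1, hτ₁]; linarith
  · rw [hτ1]
    exact isClassicalNSSolutionOn_vel_forceL hL0 hLb0 hε (by rw [hτ₁]; linarith)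
  · rw [vel_zero]; rfl
  · exact ⟨Cv, hCv, fun t _ => hEv t⟩
  · exact fun t _ x => norm_vel_le hL0 hLb0 hslab t x
  · exact fun x => norm_vel_le hL0 hLb0 hslab _ x
  · intro t ht
    rw [hτ1] at ht
    refine le_trans (lintegral_mono fun x => ?_) (hF t ht)
    rw [hostScheduleL_f, ← ofReal_norm, ← ofReal_norm]
    exact pow_le_pow_left' (ENNReal.ofReal_le_ofReal (norm_forceL_le t x)) 2
  · show 2 * TowerRates.wide.Y 0 + (TowerRates.wide.Y 1 - 2 * TowerRates.wide.Y 0) / 2 <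
      1 * TowerRates.wide.Y (0 + 1)
    rw [one_mul]
    show _ < TowerRates.wide.Y 1
    linarith
  · intro t₀ T f u p h0 hT hδ hs hd hf hu hEu hMu hAu
    exact hδ₀ h0 hT hδ hs hd hf hu hEu (fun t ht x => by
      have := hMu t ht x; simpa [hostScheduleL_c₂] using this) hAu

/-- **THE TRAP `FirstEpisode` IS FALSE modulo the forced Leray short-time bound**: ecbridge-3's host,
re-scheduled with the late-faded force, is a registered level-`0` stage of a pinned (`Λ = 8`, `θ = 6/5`),
rigid, quiet wide schedule that admits NO level-`1` stage at all.
[cite: Palasek2026ElementaryModel, §3.3] [cite: Leray1934, §21 (3.15)] -/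
theorem firstEpisode_false_of_forcedLerayShortTimeBound (hH : ForcedLerayShortTimeBound) :
    ¬ FirstEpisode := by
  intro hFE
  obtain ⟨L, Lb, hL, hLb, hslab, hpush1⟩ := exists_scales
  have hL0 : 0 < L := by linarith
  have hLb0 : 0 < Lb := by linarith
  have hpush : ∀ t ∈ Icc (1 : ℝ) τfirst, ∀ x : EuclideanSpace ℝ (Fin 3), ‖resid L Lb t x‖ ≤ 1 / 200 * TowerRates.wide.Y 0 :=
    fun t ht x => hpush1 t ht.1 x
  obtain ⟨F, hF0, hF⟩ := exists_lintegral_resid_sq_le (L := L) (Lb := Lb) hL0 hLb0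
  have hY0 := wide_Y_zero_pos
  have hsep := two_mul_wide_Y_zero_lt_Y_one
  have hη : 0 < (TowerRates.wide.Y 1 - 2 * TowerRates.wide.Y 0) / 2 := by linarith
  have hM1 : 0 < 5 / 3 * TowerRates.wide.Y 1 := by
    have := TowerRates.wide_Y_one_bounds.1
    linarith
  obtain ⟨δ₀, hδ₀pos, hδ₀⟩ := hH one_pos hY0 hM1 hF0 hη
  set ε : ℝ := min δ₀ wfirst with hεdef
  have hε : 0 < ε := lt_min hδ₀pos wfirst_pos
  have hεw : ε ≤ wfirst := min_le_right _ _
  have hεδ : ε ≤ δ₀ := min_le_left _ _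
  obtain ⟨s₀⟩ := nonempty_stage_zero_lateFade hL hLb hε hpush hεw hslab
  obtain ⟨s₁, -⟩ := hFE (hostScheduleL L Lb ε hL hLb hε hpush) (hostScheduleL_pins hL hLb hε hpush)
    (hostScheduleL_rigid hL hLb hε hpush) (hostScheduleL_quiet hL hLb hε hpush) s₀
  exact (isEmpty_stage_one_lateFade hL hLb hε hεw hεδ hpush hslab hF hδ₀).false s₁

/-- The same for `HeredityAt 0` (`FirstEpisode` is `HeredityAt 0` by `Iff.rfl`). [folklore] -/
theorem heredityAt_zero_false_of_forcedLerayShortTimeBound (hH : ForcedLerayShortTimeBound) :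
    ¬ HeredityAt 0 :=
  fun h => firstEpisode_false_of_forcedLerayShortTimeBound hH (firstEpisode_iff_heredityAt_zero.2 h)

/-- The same for `HeredityFrom 0` (heredity from level `0` contains the first episode). [folklore] -/
theorem heredityFrom_zero_false_of_forcedLerayShortTimeBound (hH : ForcedLerayShortTimeBound) :
    ¬ HeredityFrom 0 :=
  fun h => heredityAt_zero_false_of_forcedLerayShortTimeBound hH (h.heredityAt le_rfl)

/-- The same for the heredity WITNESS at level `0` (`HeredityAt 0 ↔ HeredityWitness 0`, ecbridge-6).
[folklore] -/
theorem heredityWitness_zero_false_of_forcedLerayShortTimeBound (hH : ForcedLerayShortTimeBound) :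
    ¬ HeredityWitness 0 :=
  fun h => heredityAt_zero_false_of_forcedLerayShortTimeBound hH
    (heredityAt_zero_iff_heredityWitness_zero.2 h)

/-- REDUCTION TO THE OSEEN PAIRING ESTIMATE (engine files `PalasekTowerHostLateFadeEngine{,Bound}`,
p448301 / p448612): the engine hypothesis `Host.ForcedLerayShortTimeBound` follows from the single scalar
pairing estimate `Host.Engine.OseenConvectBound` (`|∫⟪a, (a·∇) 𝒢_{ε+s} e⟫| ≤ C₁ s^{-1/2} M² |e|` for bounded
finite-energy fields `a`, `|a| ≤ M`), by Tao's tested forced Duhamel formula and the heat-kernel bounds; hence so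
does `¬ FirstEpisode`. [cite: Palasek2026ElementaryModel, §4 item 2] [cite: Leray1934, §20 (3.5)] -/
theorem firstEpisode_false_of_oseenConvectBound (hA : Engine.OseenConvectBound) : ¬ FirstEpisode :=
  firstEpisode_false_of_forcedLerayShortTimeBound (Engine.forcedLerayShortTimeBound_of_oseenConvectBound hA)

/-- The same for `HeredityAt 0`. [folklore] -/
theorem heredityAt_zero_false_of_oseenConvectBound (hA : Engine.OseenConvectBound) : ¬ HeredityAt 0 :=
  heredityAt_zero_false_of_forcedLerayShortTimeBound (Engine.forcedLerayShortTimeBound_of_oseenConvectBound hA)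

/-- The same for `HeredityFrom 0`. [folklore] -/
theorem heredityFrom_zero_false_of_oseenConvectBound (hA : Engine.OseenConvectBound) : ¬ HeredityFrom 0 :=
  heredityFrom_zero_false_of_forcedLerayShortTimeBound
    (Engine.forcedLerayShortTimeBound_of_oseenConvectBound hA)

/-- The same for the heredity WITNESS at level `0`. [folklore] -/
theorem heredityWitness_zero_false_of_oseenConvectBound (hA : Engine.OseenConvectBound) :
    ¬ HeredityWitness 0 :=
  heredityWitness_zero_false_of_forcedLerayShortTimeBound
    (Engine.forcedLerayShortTimeBound_of_oseenConvectBound hA)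

/-! ## The release is unconditional: `FirstEpisode = HeredityAt 0` is FALSE

The engine lemma is now a theorem: `Host.Engine.oseenConvectBound_holds`
(`FluidComputer/PalasekTowerHostLateFadeEngineOseen.lean`) proves the Oseen pairing estimate, whence
`Host.ForcedLerayShortTimeBound` (p448612) and the four negations below hold with NO hypothesis. WHAT THIS IS
NOT: not a refutation of any ITEM — `EpisodeBase` (stmt-19179, `EpisodeBaseG`, ∃-form over hosts) is untouched;
what is false is the ∀-over-hosts form `FirstEpisode` (= `HeredityAt 0` = `HeredityWitness 0`), hence also
`HeredityFrom 0`: the late-faded host schedule `hostScheduleL` is pinned `(8, 6/5)`, rigid and quiet, carries a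
registered level-0 stage, and admits NO level-1 stage (hold-and-release: after the force is released at
`τfirst - ε` the speed stays `≤ 2·Y₀ + η < Y₁` up to `τ₁` by the forced short-time sup bound). -/

/-- **`FirstEpisode` is false** (unconditional): the ∀-over-hosts first-episode claim `HeredityAt 0` fails on
the late-faded host schedule. [cite: Palasek2026ElementaryModel, §4 item 2] [cite: Leray1934, §20 (3.5)] -/
theorem not_firstEpisode : ¬ FirstEpisode :=
  firstEpisode_false_of_oseenConvectBound Engine.oseenConvectBound_holds

/-- **`HeredityAt 0` is false** (unconditional). [folklore] -/
theorem not_heredityAt_zero : ¬ HeredityAt 0 :=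
  heredityAt_zero_false_of_oseenConvectBound Engine.oseenConvectBound_holds

/-- **`HeredityFrom 0` is false** (unconditional; `HeredityFrom 2 = HeredityFromTwo` of the route is NOT
addressed). [folklore] -/
theorem not_heredityFrom_zero : ¬ HeredityFrom 0 :=
  heredityFrom_zero_false_of_oseenConvectBound Engine.oseenConvectBound_holds

/-- **`HeredityWitness 0` is false** (unconditional). [folklore] -/
theorem not_heredityWitness_zero : ¬ HeredityWitness 0 :=
  heredityWitness_zero_false_of_oseenConvectBound Engine.oseenConvectBound_holds

end Summit.NavierStokesRegularity.FirstEpisodeHoldRelease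

end
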